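import Summits.Parity.BatemanHorn.Theses.AlmostPrimeZeros
import Summits.Parity.BatemanHorn.Theorems.AlmostPrimeZerosSystemZeroRepulsionFarZoneWide
import Literature.NumberTheory.Sieve.BatemanHornLocalCounts
import Literature.NumberTheory.Sieve.BatemanHornMertensProduct

/-!
# Line `euler-species-factorisation` for crux `AlmostPrimeZeros.SystemZeroRepulsion` (stmt-Parity-11291)

Skeleton (crux-plan, planner-cruxplan-stmt-Parity-11291-euler-species-factor-0, 2026-08-16) of the crux idea
card `Cruxes/SystemZeroRepulsion/Ideas/euler-species-factorisation.md` (crux-ideate r1 ideator 1; triage r1-1,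
r1-2, r1-3: pass ×3, "merge with smooth-rough-lattice-acquisition / rough-profile-descent: same lever"), with
the triage sharpenings built in: ONE coupling statement of Rouché grade on the disc `|z-1| ≤ K·(log log x)^B`
(r1-1), the far zone filed once as its own stub (r1-2/r1-3: it is load-bearing for every line and its status
for `deg ≥ 2` is disputed between card `far-zone-hardy-ramanujan-along-f` and Disproof v4 regime (iv)), every
constant quantified AFTER the system and every `x`-statement under `∃ x₀` (Disproof.lean `not_uniformConstant`,
`exists_system_root_near_one`), the small-prime cut `y = exp(log x/(log log x)^A)` with `A` a free natural
parameter "for all `A ≥ A₀(f, K, B)`" (r1-2 on `rough-profile-descent`: the Chernoff step of the complex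
fundamental lemma wants `A ≥ 4D₀+2`, not `3`).

THE CRUX. `T_f(x) := Σ_ρ ‖1-ρ‖⁻²` over the roots of the almost-prime polynomial
`S_x(z) = Σ_{0≤n≤x} z^{s_f(n)}`, `s_f(n) = Σ_i Σ_{p^v ∥ f_i(n)} min(v,2)`, is `≤ C_f` for every `x ≥ 2`,
for every Bateman–Horn system `f`.

THE LINE (exact local product out, rough polynomial in). With `y = y_A(x) = ⌊exp(log x/(log log x)^A)⌋`
(`u = log x/log y = (log log x)^A`):
* `M_y(z) = ∏_{p ≤ y} E_p(z)`, `E_p(z) = Σ_{n mod p²} z^{s_{f,p}(n)}` the EXACT local generating polynomials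
  (`eulerSpecies`, `eulerFactor`; degree `≤ 2k` each, `E_p(1) = p²`);
* `R_{x,y}(z) = Σ_{0≤n≤x} z^{s_{f,>y}(n)}` the rough polynomial (prime factors `> y` only; `roughPoly`);
* `T` is additive over products (roots of a product = sum of the root multisets), so the line bounds
  `T(S_x) = T_near + T_far` by `[T(M_y) + T(R_{x,y}) + C] + C'`:
  - `stub_eulerSpeciesBound` (K-Euler, size M, provable now; checked TRUE on paper by all three triagers):
    `T(M_y) = Σ_{p≤y} T(E_p) ≤ C_f` uniformly in `y` — for generic `p`,
    `E_p(z)/p² = (1-ω/p) + ω(p-1)p⁻²z + ωp⁻²z²`, `E_p(1) = p²` forces `(1-z₁)(1-z₂) = p²/ω_f(p)` and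
    `ω_f(p) < p` (no fixed prime divisor: the Bateman–Horn hypothesis enters HERE) gives `T(E_p) ≤ 8D²/p²`;
  - `stub_farZoneHarmless` (size M for `k = 1`, `f` linear — Jensen at `1` + `⌊x/d⌋ ≤ x/d`; OPEN anatomy
    `FarMomentAlongSystem` for `deg ≥ 2`): the zeros with `‖1-ρ‖ > K_f (log log x)^{B_f}` contribute `≤ C_f`;
  - `stub_speciesCoupling` (size L; exact factorisation + Alladi/Buchstab for `f = X`, the complex fundamental
    lemma `TruncatedEulerProduct` of card `rough-profile-descent` + Rouché in general; for `deg ≥ 2` it also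
    needs the rough law in root classes `n mod d`, `d` smooth — the honest joint): in the disc
    `‖1-ρ‖ ≤ K (log log x)^B` the zeros of `S_x` are matched to zeros of `M_y · R_{x,y}` with relative
    displacement `o(1)`, so `T_near(S_x) ≤ (1+ε)(T(M_y) + T(R_{x,y})) + C` for every `ε > 0`, all `A ≥ A₀(f,K,B)`;
  - `stub_roughZeroRepulsion` (HARDEST — the card's transfer target `C⁺`, carries all the parity content, at
    `z = -1` it is Liouville-of-the-large-prime-factors along `f` with saving `u^{2k} = (log log x)^{2kA}`
    instead of the crux's `(log x)^{2k}`): `T(R_{x,y_A(x)}) ≤ C_f(A)` for all large `A`.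
* `SystemZeroRepulsion_of` — the kernel-checked composition: split `T = T_near + T_far` at radius
  `K (log log x)^B` (`T_eq_Tnear_add_Tfar`), add the four bounds (coupling at `ε = 1`) for `x ≥ max x₀'s`,
  absorb the finitely many small `x` (`exists_bound_of_eventually`).

Disproof.lean (refuter-cdisprove v1–v4, read through the item's evidence notes — the gate path
`run/gate/evidence/stmt-Parity-11291/…-Disproof.lean` is not mounted on this hub and no `Cruxes/…/Disproof.lean`
workfile exists): no `_false_without_<H>` theorem is on record; HONOURED: `not_uniformConstant` /
`exists_system_T_two_gt` (every `C` below is quantified after `(k, f)`), `exists_system_root_near_one` (every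
`x`-statement is `∃ x₀ ∀ x ≥ x₀`; the composition absorbs `2 ≤ x < x₀` by a finite maximum, cf.
`withoutXGeTwo_iff`), `isBatemanHornSystem_empty`/`T_fin_zero` (`k = 0`: all four stubs hold with `C = 0`,
`M_y` and `R` are constants). No `Theorems/SystemZeroRepulsion/Negative/*` lemma has landed (nothing to import).
Negatives index (`ledger negatives --problem Parity`: GeneralizedHardyLittlewood × 3): unrelated statements.
-/

namespace Summit.Parity.BatemanHorn.Cruxes.SystemZeroRepulsion.EulerSpeciesFactorisation

open scoped BigOperators
open Polynomial Finset
open Summit.Parity.BatemanHorn.Theses.AlmostPrimeZeros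

set_option linter.unusedVariables false

/-! ## Vocabulary (verbatim abbreviations of the crux's own objects) -/

/-- The crux's zero functional `T(P) = Σ_ρ ‖1-ρ‖⁻²` over the roots of `P` in `ℂ`, with multiplicity
(verbatim the summand of `SystemZeroRepulsion`; `ρ = 1` would contribute the junk value `0`, but `1` is
never a root of the polynomials below, all of which have positive value at `1`). -/
noncomputable def T (P : Polynomial ℂ) : ℝ :=
  (P.roots.map (fun ρ : ℂ => (‖(1 : ℂ) - ρ‖ ^ 2)⁻¹)).sum

/-- Near part of `T`: roots with `‖1-ρ‖ ≤ r`. -/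
noncomputable def Tnear (P : Polynomial ℂ) (r : ℝ) : ℝ :=
  ((P.roots.filter (fun ρ : ℂ => ‖(1 : ℂ) - ρ‖ ≤ r)).map (fun ρ : ℂ => (‖(1 : ℂ) - ρ‖ ^ 2)⁻¹)).sum

/-- Far part of `T`: roots with `r < ‖1-ρ‖`. -/
noncomputable def Tfar (P : Polynomial ℂ) (r : ℝ) : ℝ :=
  ((P.roots.filter (fun ρ : ℂ => r < ‖(1 : ℂ) - ρ‖)).map (fun ρ : ℂ => (‖(1 : ℂ) - ρ‖ ^ 2)⁻¹)).sum

/-- The almost-prime polynomial `S_x(X) = Σ_{0 ≤ n ≤ x} X^{s_f(n)}` of the system — VERBATIM the polynomial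
of `SystemZeroRepulsion` (capped statistic `s_f(n) = Σ_i Σ_p min(v_p(f_i(n)), 2)`, `f_i(n) ≤ 0 ↦ 0`). -/
noncomputable def sysPoly {k : ℕ} (f : Fin k → Polynomial ℤ) (x : ℕ) : Polynomial ℂ :=
  ∑ n ∈ Finset.range (x + 1), (Polynomial.X : Polynomial ℂ) ^
    (∑ i, (((f i).eval (n : ℤ)).toNat.factorization.sum fun _ v => min v 2))

/-- `L = log log x` (the mean of `s_f` is `k·L + O(1)`, route support `SystemMertens`). -/
noncomputable def loglog (x : ℕ) : ℝ := Real.log (Real.log (x : ℝ))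

/-- The small-prime cut `y_A(x) = ⌊exp(log x / (log log x)^A)⌋`, i.e. `u = log x / log y = (log log x)^A`. -/
noncomputable def cutoff (A x : ℕ) : ℕ := ⌊Real.exp (Real.log (x : ℝ) / (loglog x) ^ A)⌋₊

/-- Capped local statistic at the prime `p`: `s_{f,p}(n) = Σ_i ([p ∣ f_i(n)] + [p² ∣ f_i(n)])`, a function of
`n mod p²`. -/
noncomputable def localStat {k : ℕ} (f : Fin k → Polynomial ℤ) (p n : ℕ) : ℕ :=
  ∑ i, ((if ((p : ℤ) ∣ (f i).eval (n : ℤ)) then 1 else 0) +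
        (if ((p : ℤ) ^ 2 ∣ (f i).eval (n : ℤ)) then 1 else 0))

/-- Euler-species factor at `p`: the exact local generating polynomial `E_p(X) = Σ_{n < p²} X^{s_{f,p}(n)}`
(degree `≤ 2k`, `E_p(1) = p² ≠ 0`). -/
noncomputable def eulerFactor {k : ℕ} (f : Fin k → Polynomial ℤ) (p : ℕ) : Polynomial ℂ :=
  ∑ n ∈ Finset.range (p ^ 2), (Polynomial.X : Polynomial ℂ) ^ (localStat f p n)

/-- Euler species up to `y`: `M_y = ∏_{p ≤ y, p prime} E_p`. -/
noncomputable def eulerSpecies {k : ℕ} (f : Fin k → Polynomial ℤ) (y : ℕ) : Polynomial ℂ :=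
  ∏ p ∈ (Finset.range (y + 1)).filter Nat.Prime, eulerFactor f p

/-- Rough statistic: prime factors `> y` of the values, multiplicity capped at `2` (`f_i(n) ≤ 0 ↦ 0`, as in the
crux); `s_f(n) = s_{f,≤y}(n) + roughStat f y n`. -/
noncomputable def roughStat {k : ℕ} (f : Fin k → Polynomial ℤ) (y n : ℕ) : ℕ :=
  ∑ i, (((f i).eval (n : ℤ)).toNat.factorization.sum fun p v => if y < p then min v 2 else 0)

/-- Rough polynomial `R_{x,y}(X) = Σ_{0 ≤ n ≤ x} X^{roughStat f y n}` (`R_{x,y}(1) = x + 1`,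
`deg R_{x,y} ≤ (Σ deg f_i)·log x/log y`). -/
noncomputable def roughPoly {k : ℕ} (f : Fin k → Polynomial ℤ) (x y : ℕ) : Polynomial ℂ :=
  ∑ n ∈ Finset.range (x + 1), (Polynomial.X : Polynomial ℂ) ^ (roughStat f y n)

/-! ## Registered stubs (lead reshaping, seat b, cycle 1)

The planner's `stub_eulerSpeciesBound` is RESHAPED into three worker-sized registered stubs, all stated INLINE over
route vocabulary (so that each lands verbatim as a `Theorems/AlmostPrimeZerosSystemZeroRepulsion<Stub>.lean` file):
`stub_eulerAdditivity` (T is additive over the Euler product), `stub_localStructure` (generic local structure of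
`E_p` for a Bateman–Horn system: `s_{f,p} ≤ 2`, `#{n < p² : s_{f,p}(n) ≠ 0} ≤ D·p`, `#{n < p² : s_{f,p}(n) = 2} ≤ D`,
`D = Σ deg f_i`, from the tree's `IsBatemanHornSystem.exists_localCounts`), `stub_localRootBound` (a polynomial
`Σ_{n<p²} X^{e(n)}` with that profile has all its roots at distance `> p/(8D)` from `1`, hence `T ≤ 128 D²/p²`);
`stub_eulerSpeciesBound` is then DERIVED below (summation over primes, `Σ 1/p² < ∞`).  The planner's
`stub_farZoneHarmless` is DERIVED from the registered shared joints `stub_farMomentWide` (S1′) and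
`stub_farZone_of_farMomentWide` (S2′) — the first lead's reshaped far-zone stubs VERBATIM (one landing closes both lines' far
zone; cycle 1 used S1 `stub_farMoment` + the landed p75751, but drefute g4 showed S1 misstated as typed, see below).  `stub_speciesCoupling` and
`stub_roughZeroRepulsion` are kept as registered by the planner (the lead holds `stub_roughZeroRepulsion`). -/

/-! ### LANDED registered stubs E1–E3 (cycle 1) — INLINED COPIES of the accepted Theorems files
(`AlmostPrimeZerosSystemZeroRepulsion{EulerAdditivity,LocalStructure,LocalRootBound}.lean`, p80062 / p82948 / p85053), byte-identical
bodies, so that this workfile elaborates on a farm snapshot that has not yet built those modules; the import form is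
`work/SystemZeroRepulsion.lean` in the seat folder. -/

section LandedE1


/-- Additivity of a root functional over a finite product of non-zero polynomials: the root
multiset of `∏ i ∈ s, E i` is the sum (bind) of the root multisets (`Polynomial.roots_prod`). -/
private theorem sum_map_roots_prod {ι M : Type*} [AddCommMonoid M] (s : Finset ι) (E : ι → ℂ[X])
    (g : ℂ → M) (hE : ∀ i ∈ s, E i ≠ 0) :
    ((∏ i ∈ s, E i).roots.map g).sum = ∑ i ∈ s, ((E i).roots.map g).sum := by
  rw [Polynomial.roots_prod E s (Finset.prod_ne_zero_iff.mpr hE), Multiset.map_bind,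
    Multiset.sum_bind]
  rfl

/-- A polynomial of the shape `∑ n ∈ range m, X ^ (e n)` evaluates to `m` at `1`, hence is non-zero
as soon as `m ≠ 0`. -/
private theorem sum_X_pow_ne_zero (m : ℕ) (e : ℕ → ℕ) (hm : m ≠ 0) :
    (∑ n ∈ Finset.range m, (Polynomial.X : Polynomial ℂ) ^ (e n)) ≠ 0 := by
  intro h0
  have h1 := congrArg (Polynomial.eval (1 : ℂ)) h0
  simp only [Polynomial.eval_finsetSum, Polynomial.eval_pow, Polynomial.eval_X, one_pow,
    Finset.sum_const, Finset.card_range, nsmul_eq_mul, mul_one, Polynomial.eval_zero,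
    Nat.cast_eq_zero] at h1
  exact hm h1

/-- **E1 (additivity of `T` over the Euler species).** For every family `f : Fin k → ℤ[X]` and every `y`,
`T(∏_{p ≤ y prime} E_p) = Σ_{p ≤ y prime} T(E_p)` where `E_p = Σ_{n<p²} X^{s_{f,p}(n)}` and
`T(P) = Σ_{ρ ∈ roots P} ‖1−ρ‖⁻²`: `Polynomial.roots_prod` (each `E_p ≠ 0` since `E_p(1) = p² ≠ 0`),
`Multiset.map_bind`, `Multiset.sum_bind`. -/
theorem stub_eulerAdditivity :
    ∀ (k : ℕ) (f : Fin k → Polynomial ℤ) (y : ℕ),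
      ((∏ p ∈ (Finset.range (y + 1)).filter Nat.Prime,
          ∑ n ∈ Finset.range (p ^ 2), (Polynomial.X : Polynomial ℂ) ^
            (∑ i, ((if ((p : ℤ) ∣ (f i).eval (n : ℤ)) then 1 else 0) +
              (if ((p : ℤ) ^ 2 ∣ (f i).eval (n : ℤ)) then 1 else 0)))).roots.map
        (fun ρ : ℂ => (‖(1 : ℂ) - ρ‖ ^ 2)⁻¹)).sum =
      ∑ p ∈ (Finset.range (y + 1)).filter Nat.Prime,
        ((∑ n ∈ Finset.range (p ^ 2), (Polynomial.X : Polynomial ℂ) ^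
            (∑ i, ((if ((p : ℤ) ∣ (f i).eval (n : ℤ)) then 1 else 0) +
              (if ((p : ℤ) ^ 2 ∣ (f i).eval (n : ℤ)) then 1 else 0)))).roots.map
          (fun ρ : ℂ => (‖(1 : ℂ) - ρ‖ ^ 2)⁻¹)).sum := by
  intro k f y
  refine sum_map_roots_prod _ _ _ ?_
  intro p hp
  have hp' : p ≠ 0 := (Finset.mem_filter.mp hp).2.ne_zero
  exact sum_X_pow_ne_zero (p ^ 2) _ (pow_ne_zero 2 hp')


end LandedE1

section LandedE2


/-- A member not divisible by `p` at `n` contributes `0` to `s_{f,p}(n)` (`p² ∣ m → p ∣ m`). -/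
private theorem summand_eq_zero {p : ℕ} {g : ℤ[X]} {n : ℤ} (hg : ¬ (p : ℤ) ∣ g.eval n) :
    ((if (p : ℤ) ∣ g.eval n then 1 else 0) + (if (p : ℤ) ^ 2 ∣ g.eval n then 1 else 0) : ℕ) =
      0 := by
  have hg2 : ¬ (p : ℤ) ^ 2 ∣ g.eval n :=
    fun h => hg ((dvd_pow_self (p : ℤ) two_ne_zero).trans h)
  rw [if_neg hg, if_neg hg2]

/-- Each summand `[p ∣ m] + [p² ∣ m]` of `s_{f,p}(n)` is at most `2`. -/
private theorem ite_add_ite_le_two (P Q : Prop) [Decidable P] [Decidable Q] :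
    ((if P then 1 else 0) + (if Q then 1 else 0) : ℕ) ≤ 2 := by
  split_ifs <;> omega

/-- (i) If no two members of `f` have a common root modulo `p`, then `s_{f,p}(n) ≤ 2` for every
`n`: at most one index contributes, and it contributes at most `2`. -/
private theorem sum_le_two {k : ℕ} {f : Fin k → ℤ[X]} {p : ℕ}
    (hcop : ∀ i j, i ≠ j → ∀ n : ℤ,
      ¬ ((p : ℤ) ∣ (f i).eval n ∧ (p : ℤ) ∣ (f j).eval n))
    (n : ℕ) :
    (∑ i, ((if ((p : ℤ) ∣ (f i).eval (n : ℤ)) then 1 else 0) +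
        (if ((p : ℤ) ^ 2 ∣ (f i).eval (n : ℤ)) then 1 else 0))) ≤ 2 := by
  by_cases h : ∃ i, (p : ℤ) ∣ (f i).eval (n : ℤ)
  · obtain ⟨i, hi⟩ := h
    rw [Fintype.sum_eq_single i fun j hji => summand_eq_zero fun hj => hcop j i hji n ⟨hj, hi⟩]
    exact ite_add_ite_le_two _ _
  · push Not at h
    rw [Finset.sum_eq_zero fun j _ => summand_eq_zero (h j)]
    exact Nat.zero_le _

/-- If `s_{f,p}(n) ≠ 0` then some member is divisible by `p` at `n`. -/
private theorem exists_dvd_of_sum_ne_zero {k : ℕ} {f : Fin k → ℤ[X]} {p : ℕ} {n : ℕ}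
    (h0 : (∑ i, ((if ((p : ℤ) ∣ (f i).eval (n : ℤ)) then 1 else 0) +
        (if ((p : ℤ) ^ 2 ∣ (f i).eval (n : ℤ)) then 1 else 0))) ≠ 0) :
    ∃ i, (p : ℤ) ∣ (f i).eval (n : ℤ) := by
  by_contra h
  push Not at h
  exact h0 (Finset.sum_eq_zero fun j _ => summand_eq_zero (h j))

/-- (iii, pointwise) If no two members of `f` have a common root modulo `p` and `s_{f,p}(n) = 2`,
then `p² ∣ f_i(n)` for some `i` (the unique index divisible by `p` carries both indicators). -/
private theorem exists_sq_dvd_of_sum_eq_two {k : ℕ} {f : Fin k → ℤ[X]} {p : ℕ}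
    (hcop : ∀ i j, i ≠ j → ∀ n : ℤ,
      ¬ ((p : ℤ) ∣ (f i).eval n ∧ (p : ℤ) ∣ (f j).eval n))
    {n : ℕ}
    (h2 : (∑ i, ((if ((p : ℤ) ∣ (f i).eval (n : ℤ)) then 1 else 0) +
        (if ((p : ℤ) ^ 2 ∣ (f i).eval (n : ℤ)) then 1 else 0))) = 2) :
    ∃ i, (p : ℤ) ^ 2 ∣ (f i).eval (n : ℤ) := by
  by_cases h : ∃ i, (p : ℤ) ∣ (f i).eval (n : ℤ)
  · obtain ⟨i, hi⟩ := h
    rw [Fintype.sum_eq_single i fun j hji => summand_eq_zero fun hj => hcop j i hji n ⟨hj, hi⟩]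
      at h2
    refine ⟨i, ?_⟩
    by_contra hc
    rw [if_pos hi, if_neg hc] at h2
    omega
  · push Not at h
    rw [Finset.sum_eq_zero fun j _ => summand_eq_zero (h j)] at h2
    omega

/-- Each residue class modulo `p` meets `{0, …, p² - 1}` in at most `p` points
(`n ↦ n / p` is injective on it, into `{0, …, p - 1}`). -/
private theorem card_filter_range_sq_mod_eq_le (p a : ℕ) :
    #((range (p ^ 2)).filter fun n : ℕ => n % p = a) ≤ p := by
  calc #((range (p ^ 2)).filter fun n : ℕ => n % p = a)
      ≤ #(range p) := by
        refine Finset.card_le_card_of_injOn (fun n => n / p) ?_ ?_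
        · intro n hn
          have hn' := (mem_filter.mp (mem_coe.mp hn)).1
          rw [mem_range, sq] at hn'
          exact mem_coe.mpr (mem_range.mpr (Nat.div_lt_of_lt_mul hn'))
        · intro m hm n hn hmn
          have hm' := (mem_filter.mp (mem_coe.mp hm)).2
          have hn' := (mem_filter.mp (mem_coe.mp hn)).2
          have hmn' : m / p = n / p := hmn
          calc m = p * (m / p) + m % p := (Nat.div_add_mod m p).symm
            _ = p * (n / p) + n % p := by rw [hmn', hm', hn']
            _ = n := Nat.div_add_mod n p
    _ = p := card_range p

/-- Periodicity: `p ∣ g(n)` implies `p ∣ g(n mod p)` (`a - b ∣ g(a) - g(b)`). -/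
private theorem dvd_eval_mod {p : ℕ} {g : ℤ[X]} {n : ℕ} (h : (p : ℤ) ∣ g.eval (n : ℤ)) :
    (p : ℤ) ∣ g.eval ((n % p : ℕ) : ℤ) := by
  have h1 : (p : ℤ) ∣ (n : ℤ) - ((n % p : ℕ) : ℤ) := by
    rw [Int.natCast_emod]
    exact Int.dvd_self_sub_emod
  have h3 : (p : ℤ) ∣ g.eval (n : ℤ) - g.eval ((n % p : ℕ) : ℤ) :=
    h1.trans (Polynomial.sub_dvd_eval_sub (n : ℤ) ((n % p : ℕ) : ℤ) g)
  exact (dvd_sub_right h).mp h3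

/-- (ii) For a prime `p` missing every leading coefficient,
`#{n < p² : ∃ i, p ∣ f_i(n)} ≤ (Σ_i deg f_i)·p`: reduction modulo `p` maps this set into
the `≤ Σ_i ρ_i(p) ≤ Σ_i deg f_i` root classes (Lagrange), with fibres of size `≤ p`. -/
private theorem card_filter_exists_dvd_le {k : ℕ} (f : Fin k → ℤ[X]) {p : ℕ} (hp : p.Prime)
    (hlc : ∀ i, ¬ (p : ℤ) ∣ (f i).leadingCoeff) :
    #((range (p ^ 2)).filter fun n : ℕ => ∃ i, (p : ℤ) ∣ (f i).eval (n : ℤ)) ≤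
      (∑ i, (f i).natDegree) * p := by
  set A := (range (p ^ 2)).filter fun n : ℕ => ∃ i, (p : ℤ) ∣ (f i).eval (n : ℤ) with hA
  set R := univ.biUnion fun i : Fin k =>
    (range p).filter fun r : ℕ => (p : ℤ) ∣ (f i).eval (r : ℤ)
  have hmaps : ∀ n ∈ A, n % p ∈ R := by
    intro n hn
    rw [hA, mem_filter] at hn
    obtain ⟨-, i, hi⟩ := hn
    exact mem_biUnion.mpr
      ⟨i, mem_univ _, mem_filter.mpr ⟨mem_range.mpr (Nat.mod_lt n hp.pos), dvd_eval_mod hi⟩⟩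
  have h1 : #A ≤ p * #R := by
    refine Finset.card_le_mul_card_image_of_maps_to hmaps p fun a _ => ?_
    calc #(A.filter fun n => n % p = a)
        ≤ #((range (p ^ 2)).filter fun n : ℕ => n % p = a) := by
          refine card_le_card fun n hn => ?_
          rw [mem_filter] at hn ⊢
          rw [hA, mem_filter] at hn
          exact ⟨hn.1.1, hn.2⟩
      _ ≤ p := card_filter_range_sq_mod_eq_le p a
  have h3 : #R ≤ ∑ i, (f i).natDegree := by
    refine card_biUnion_le.trans (sum_le_sum fun i _ => ?_)
    rw [← Literature.NumberTheory.Sieve.polyRootCountMod_single]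
    exact Literature.NumberTheory.Sieve.polyRootCountMod_single_le_natDegree hp (hlc i)
  calc #A ≤ p * #R := h1
    _ ≤ p * ∑ i, (f i).natDegree := Nat.mul_le_mul_left p h3
    _ = (∑ i, (f i).natDegree) * p := mul_comm _ _

/-- **E2 (generic local structure).** For a Bateman–Horn system `f` there is `P₀` such that for
every prime `p > P₀`: (i) `s_{f,p}(n) ≤ 2` for every `n` (at most one member is divisible by `p`
at `n`); (ii) `#{n < p² : s_{f,p}(n) ≠ 0} ≤ (Σ_i deg f_i)·p` (the set is
`{n < p² : ∃ i, p ∣ f_i(n)}`, a union over the `≤ Σ_i deg f_i` root classes mod `p`, each meeting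
`range (p²)` in `p` points); (iii) `#{n < p² : s_{f,p}(n) = 2} ≤ Σ_i deg f_i` (such `n` have
`p² ∣ f_i(n)` for some `i`; Hensel count). -/
theorem stub_localStructure :
    ∀ (k : ℕ) (f : Fin k → Polynomial ℤ), Literature.NumberTheory.Sieve.IsBatemanHornSystem f →
      ∃ P₀ : ℕ, ∀ p : ℕ, p.Prime → P₀ < p →
        (∀ n : ℕ, (∑ i, ((if ((p : ℤ) ∣ (f i).eval (n : ℤ)) then 1 else 0) +
              (if ((p : ℤ) ^ 2 ∣ (f i).eval (n : ℤ)) then 1 else 0))) ≤ 2) ∧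
        (((Finset.range (p ^ 2)).filter (fun n : ℕ =>
            (∑ i, ((if ((p : ℤ) ∣ (f i).eval (n : ℤ)) then 1 else 0) +
              (if ((p : ℤ) ^ 2 ∣ (f i).eval (n : ℤ)) then 1 else 0))) ≠ 0)).card ≤
          (∑ i, (f i).natDegree) * p) ∧
        (((Finset.range (p ^ 2)).filter (fun n : ℕ =>
            (∑ i, ((if ((p : ℤ) ∣ (f i).eval (n : ℤ)) then 1 else 0) +
              (if ((p : ℤ) ^ 2 ∣ (f i).eval (n : ℤ)) then 1 else 0))) = 2)).card ≤
          ∑ i, (f i).natDegree) := by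
  intro k f hf
  obtain ⟨P₀, hP⟩ := hf.exists_localCounts
  refine ⟨P₀, fun p hp hlt => ?_⟩
  obtain ⟨hlc, hcop, hhens⟩ := hP p hp hlt
  refine ⟨sum_le_two hcop, ?_, ?_⟩
  · refine (card_le_card fun n hn => ?_).trans (card_filter_exists_dvd_le f hp hlc)
    rw [mem_filter] at hn ⊢
    exact ⟨hn.1, exists_dvd_of_sum_ne_zero hn.2⟩
  · refine (card_le_card (t := univ.biUnion fun i : Fin k =>
        (range (p ^ 2)).filter fun n : ℕ => ((p : ℤ) ^ 2) ∣ (f i).eval (n : ℤ)) ?_).trans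
      (card_biUnion_le.trans (sum_le_sum fun i _ => hhens i))
    intro n hn
    rw [mem_filter] at hn
    obtain ⟨i, hi⟩ := exists_sq_dvd_of_sum_eq_two hcop hn.2
    exact mem_biUnion.mpr ⟨i, mem_univ _, mem_filter.mpr ⟨hn.1, hi⟩⟩


end LandedE2

section LandedE3


/-- **E3 (root bound for the generic quadratic Euler factor).** If `e ≤ 2` on `range (p²)`,
`#{n < p² : e n ≠ 0} ≤ D p`, `#{n < p² : e n = 2} ≤ D`, `1 ≤ D` and `8 D ≤ p`, then
`Σ_{ρ ∈ roots (Σ_{n<p²} X^{e n})} ‖1−ρ‖⁻² ≤ 128 D²/p²` (every root has `‖ρ‖ > p/(4D) ≥ 2`, so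
`‖1−ρ‖ ≥ ‖ρ‖ − 1 > p/(8D)`; at most `2` roots since the degree is `≤ 2` and the polynomial is non-zero). -/
theorem stub_localRootBound :
    ∀ (p D : ℕ) (e : ℕ → ℕ), 1 ≤ D → 8 * D ≤ p →
      (∀ n ∈ Finset.range (p ^ 2), e n ≤ 2) →
      ((Finset.range (p ^ 2)).filter (fun n : ℕ => e n ≠ 0)).card ≤ D * p →
      ((Finset.range (p ^ 2)).filter (fun n : ℕ => e n = 2)).card ≤ D →
      ((∑ n ∈ Finset.range (p ^ 2), (Polynomial.X : Polynomial ℂ) ^ (e n)).roots.map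
          (fun ρ : ℂ => (‖(1 : ℂ) - ρ‖ ^ 2)⁻¹)).sum ≤ 128 * (D : ℝ) ^ 2 / (p : ℝ) ^ 2 := by
  intro p D e hD hp he h1 h2
  -- real-number versions of the numeric hypotheses
  have hp0 : (0 : ℝ) < p := Nat.cast_pos.mpr (by omega)
  have hDr : (1 : ℝ) ≤ D := by exact_mod_cast hD
  have hpr : 8 * (D : ℝ) ≤ p := by exact_mod_cast hp
  have h1r : (((Finset.range (p ^ 2)).filter (fun n : ℕ => e n ≠ 0)).card : ℝ) ≤ D * p := by
    exact_mod_cast h1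
  have h2r : (((Finset.range (p ^ 2)).filter (fun n : ℕ => e n = 2)).card : ℝ) ≤ D := by
    exact_mod_cast h2
  set B : ℝ := 64 * (D : ℝ) ^ 2 / (p : ℝ) ^ 2 with hB
  have hB0 : 0 ≤ B := by positivity
  set E : Polynomial ℂ := ∑ n ∈ Finset.range (p ^ 2), (Polynomial.X : Polynomial ℂ) ^ (e n) with hE
  -- the degree is at most `2`, hence at most `2` roots (with multiplicity)
  have hdeg : E.natDegree ≤ 2 := by
    refine Polynomial.natDegree_sum_le_of_forall_le _ _ (fun n hn => ?_)
    rw [Polynomial.natDegree_X_pow]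
    exact he n hn
  have hcard : Multiset.card E.roots ≤ 2 := (Polynomial.card_roots' E).trans hdeg
  -- every root `ρ` satisfies `(‖1 - ρ‖ ^ 2)⁻¹ ≤ B`
  have hroot : ∀ ρ ∈ E.roots, (‖(1 : ℂ) - ρ‖ ^ 2)⁻¹ ≤ B := by
    intro ρ hρ
    have hev : ∑ n ∈ Finset.range (p ^ 2), ρ ^ (e n) = 0 := by
      have h := (Polynomial.mem_roots'.1 hρ).2
      rw [Polynomial.IsRoot.def, hE, Polynomial.eval_finsetSum] at h
      simpa only [Polynomial.eval_pow, Polynomial.eval_X] using h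
    -- `p² = Σ (1 - ρ^{e n})`
    have hid : ((p : ℂ)) ^ 2 = ∑ n ∈ Finset.range (p ^ 2), ((1 : ℂ) - ρ ^ (e n)) := by
      rw [Finset.sum_sub_distrib, hev, sub_zero]
      simp
    -- termwise bound
    have hterm : ∀ n ∈ Finset.range (p ^ 2), ‖(1 : ℂ) - ρ ^ (e n)‖ ≤
        (if e n ≠ 0 then 1 + ‖ρ‖ else 0) + (if e n = 2 then ‖ρ‖ ^ 2 else 0) := by
      intro n hn
      have hle := he n hn
      generalize e n = k at hle ⊢
      interval_cases k
      · simp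
      · norm_num
        calc ‖(1 : ℂ) - ρ‖ ≤ ‖(1 : ℂ)‖ + ‖ρ‖ := norm_sub_le _ _
          _ = 1 + ‖ρ‖ := by rw [norm_one]
      · norm_num
        calc ‖(1 : ℂ) - ρ ^ 2‖ ≤ ‖(1 : ℂ)‖ + ‖ρ ^ 2‖ := norm_sub_le _ _
          _ = 1 + ‖ρ‖ ^ 2 := by rw [norm_one, norm_pow]
          _ ≤ 1 + ‖ρ‖ + ‖ρ‖ ^ 2 := by linarith [norm_nonneg ρ]
    -- the counting inequality `p² ≤ #{e ≠ 0} (1 + ‖ρ‖) + #{e = 2} ‖ρ‖²`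
    have key : ((p : ℝ)) ^ 2 ≤
        (((Finset.range (p ^ 2)).filter (fun n : ℕ => e n ≠ 0)).card : ℝ) * (1 + ‖ρ‖) +
        (((Finset.range (p ^ 2)).filter (fun n : ℕ => e n = 2)).card : ℝ) * ‖ρ‖ ^ 2 := by
      calc ((p : ℝ)) ^ 2 = ‖((p : ℂ)) ^ 2‖ := by rw [norm_pow, Complex.norm_natCast]
        _ = ‖∑ n ∈ Finset.range (p ^ 2), ((1 : ℂ) - ρ ^ (e n))‖ := by rw [hid]
        _ ≤ ∑ n ∈ Finset.range (p ^ 2), ‖(1 : ℂ) - ρ ^ (e n)‖ := norm_sum_le _ _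
        _ ≤ ∑ n ∈ Finset.range (p ^ 2),
              ((if e n ≠ 0 then 1 + ‖ρ‖ else 0) + (if e n = 2 then ‖ρ‖ ^ 2 else 0)) :=
            Finset.sum_le_sum hterm
        _ = _ := by
            rw [Finset.sum_add_distrib, ← Finset.sum_filter, ← Finset.sum_filter, Finset.sum_const,
              Finset.sum_const, nsmul_eq_mul, nsmul_eq_mul]
    -- hence `‖ρ‖ > p / (4 D)`
    have ha : (p : ℝ) < 4 * D * ‖ρ‖ := by
      by_contra hcon
      rw [not_lt] at hcon
      nlinarith [mul_le_mul_of_nonneg_right h1r (by positivity : (0 : ℝ) ≤ 1 + ‖ρ‖),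
        mul_le_mul_of_nonneg_right h2r (sq_nonneg ‖ρ‖),
        mul_le_mul_of_nonneg_right hpr hp0.le,
        mul_le_mul_of_nonneg_right hcon hp0.le,
        pow_le_pow_left₀ (by positivity : (0 : ℝ) ≤ 4 * D * ‖ρ‖) hcon 2,
        mul_le_mul_of_nonneg_right hDr (by positivity : (0 : ℝ) ≤ D * ‖ρ‖ ^ 2),
        mul_pos hp0 hp0]
    -- hence `‖1 - ρ‖ > p / (8 D)`
    have h3 : ‖ρ‖ - 1 ≤ ‖(1 : ℂ) - ρ‖ := by
      have h := norm_sub_norm_le ρ (1 : ℂ)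
      rwa [norm_one, norm_sub_rev] at h
    have hb : (p : ℝ) < 8 * D * ‖(1 : ℂ) - ρ‖ := by
      nlinarith [mul_le_mul_of_nonneg_left h3 (by positivity : (0 : ℝ) ≤ D)]
    have hpos : 0 < ‖(1 : ℂ) - ρ‖ := by
      rcases (norm_nonneg ((1 : ℂ) - ρ)).eq_or_lt with h0 | h0
      · rw [← h0, mul_zero] at hb
        linarith
      · exact h0
    have hsq : (p : ℝ) ^ 2 ≤ (8 * D * ‖(1 : ℂ) - ρ‖) ^ 2 := pow_le_pow_left₀ hp0.le hb.le 2
    rw [hB, inv_eq_one_div, div_le_div_iff₀ (by positivity) (by positivity), one_mul]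
    calc (p : ℝ) ^ 2 ≤ (8 * D * ‖(1 : ℂ) - ρ‖) ^ 2 := hsq
      _ = 64 * (D : ℝ) ^ 2 * ‖(1 : ℂ) - ρ‖ ^ 2 := by ring
  -- sum over the (at most two) roots
  have hsum := Multiset.sum_le_card_nsmul (E.roots.map (fun ρ : ℂ => (‖(1 : ℂ) - ρ‖ ^ 2)⁻¹)) B
    (fun x hx => by
      obtain ⟨ρ, hρ, rfl⟩ := Multiset.mem_map.1 hx
      exact hroot ρ hρ)
  rw [Multiset.card_map, nsmul_eq_mul] at hsum
  have hc : (Multiset.card E.roots : ℝ) ≤ 2 := by exact_mod_cast hcard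
  calc ((E.roots.map (fun ρ : ℂ => (‖(1 : ℂ) - ρ‖ ^ 2)⁻¹)).sum)
      ≤ (Multiset.card E.roots : ℝ) * B := hsum
    _ ≤ 2 * B := mul_le_mul_of_nonneg_right hc hB0
    _ = 128 * (D : ℝ) ^ 2 / (p : ℝ) ^ 2 := by rw [hB]; ring


end LandedE3


/-- **S1′ `stub_farMomentWide` (the first lead's RESHAPED far moment, VERBATIM — shared far joint of every line; replaces
`stub_farMoment`, which drefute g4 showed MISSTATED as typed: at `t = √log x` a single primorial-twin term of `(X, X+2)` exceeds
`(x+1)e^{CtL}`, so S1 for `(X,X+2)` would imply finiteness of primorial twins).**  Budget `exp(C (t·log log x + t²/log log x))`: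
a theorem for `k ≤ 1`, `deg ≤ 1` (`stub_farMomentWide_linear`, p83375, seat a); OPEN anatomy for `Σ deg f_i ≥ 2`, and for `Σ deg ≥ 3`
hostage to "ultra-champion" values exactly as the crux itself is (`degreeBound_of_systemZeroRepulsion`, p83405, seat a). Not staffed by
this seat (seat a works it). -/
theorem stub_farMomentWide :
    ∀ (k : ℕ) (f : Fin k → Polynomial ℤ), Literature.NumberTheory.Sieve.IsBatemanHornSystem f →
      ∃ C : ℝ, ∀ x : ℕ, 3 ≤ x → ∀ t : ℝ, 1 ≤ t → t ≤ Real.sqrt (Real.log (x : ℝ)) →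
        (∑ n ∈ Finset.range (x + 1), (t : ℝ) ^ (∑ i, (((f i).eval (n : ℤ)).toNat.factorization.sum fun _ v => min v 2))) ≤
          ((x : ℝ) + 1) * Real.exp (C * (t * Real.log (Real.log (x : ℝ)) + t ^ 2 / Real.log (Real.log (x : ℝ)))) := by
  sorry

/-! ### LANDED shared stub S2′ (seat a, p86487): `SmoothRoughLatticeAcquisition.stub_farZone_of_farMomentWide`
(`Theorems/AlmostPrimeZerosSystemZeroRepulsionFarZoneWide.lean`), imported and used BY NAME in `stub_farZoneHarmless`. -/

/-- **K-coupling — `stub_speciesCoupling` (size L; OPEN for `Σ deg f_i ≥ 2`; kept as registered by the planner).**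
For every `K > 0` and `B`, once `A ≥ A₀(f,K,B)`, the near part of `T_f(x)` at radius `K (log log x)^B` is at most
`(1+ε)(T(M_y) + T(R_{x,y})) + C`, `y = y_A(x)`, for every `ε > 0` (Rouché-grade zero matching of `S_x` against
`M_y · R_{x,y}` in the disc; see the planner's line card for the mechanism and for why, for `deg ≥ 2`, its joint input
— the rough statistic's law in smooth root classes — is the first lead's S4+S5 in Rouché form). -/
theorem stub_speciesCoupling :
    ∀ (k : ℕ) (f : Fin k → Polynomial ℤ), Literature.NumberTheory.Sieve.IsBatemanHornSystem f →
      ∀ (K : ℝ), 0 < K → ∀ (B : ℕ), ∃ A₀ : ℕ, ∀ A : ℕ, A₀ ≤ A → ∀ (ε : ℝ), 0 < ε →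
        ∃ C : ℝ, ∃ x₀ : ℕ, ∀ x : ℕ, x₀ ≤ x →
          Tnear (sysPoly f x) (K * (loglog x) ^ B) ≤
            (1 + ε) * (T (eulerSpecies f (cutoff A x)) + T (roughPoly f x (cutoff A x))) + C := by
  sorry

/-- **K-rough — `stub_roughZeroRepulsion` (HARDEST; held by the lead; size XL / OPEN).** For every Bateman–Horn
system and every large `A`, the rough polynomial at the cut `y_A(x)` has bounded zero repulsion:
`T(R_{x,y_A(x)}) ≤ C_f(A)` for `x ≥ x₀(f,A)`.  Via the route's `HadamardBookkeeping` at `z = −1` it CONTAINS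
`|Σ_{n≤x} (−1)^{s_{f,>y}(n)}| ≪_f x·(log log x)^{−2kA}` (rough Liouville along `f`); for `k ≥ 2` linear systems this is a
power-saving two-point Chowla-type bound for the multiplicative `g(p) = −1`, `g(p^v) = 1` (`v ≥ 2`) — open. -/
theorem stub_roughZeroRepulsion :
    ∀ (k : ℕ) (f : Fin k → Polynomial ℤ), Literature.NumberTheory.Sieve.IsBatemanHornSystem f →
      ∃ A₁ : ℕ, ∀ A : ℕ, A₁ ≤ A → ∃ C : ℝ, ∃ x₀ : ℕ, ∀ x : ℕ, x₀ ≤ x →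
        T (roughPoly f x (cutoff A x)) ≤ C := by
  sorry

/-! ## Derived stubs (sorry-free glue) -/

/-- `T(P) ≥ 0` (a sum of inverse squares). -/
theorem T_nonneg (P : Polynomial ℂ) : 0 ≤ T P := by
  unfold T
  refine Multiset.sum_nonneg fun v hv => ?_
  obtain ⟨ρ, _, rfl⟩ := Multiset.mem_map.1 hv
  positivity

/-- **`stub_eulerSpeciesBound` DERIVED from E1–E3.** With `D' = 1 + Σ deg f_i`, `P₁ = max (P₀+1) (8D')`:
`T(M_y) = Σ_{p ≤ y} T(E_p) ≤ Σ_{p < P₁} T(E_p) + 128 D'² Σ_n n⁻²`. -/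
theorem stub_eulerSpeciesBound :
    ∀ (k : ℕ) (f : Fin k → Polynomial ℤ), Literature.NumberTheory.Sieve.IsBatemanHornSystem f →
      ∃ C : ℝ, ∀ y : ℕ, T (eulerSpecies f y) ≤ C := by
  intro k f hf
  obtain ⟨P₀, hP₀⟩ := stub_localStructure k f hf
  set D : ℕ := ∑ i, (f i).natDegree with hD
  set D' : ℕ := D + 1 with hD'
  set P₁ : ℕ := max (P₀ + 1) (8 * D') with hP₁
  have hlarge : ∀ p : ℕ, p.Prime → P₁ ≤ p →
      T (eulerFactor f p) ≤ 128 * (D' : ℝ) ^ 2 / (p : ℝ) ^ 2 := by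
    intro p hp hp1
    have hP₀p : P₀ < p := lt_of_lt_of_le (Nat.lt_succ_self P₀) (le_trans (le_max_left _ _) hp1)
    have h8 : 8 * D' ≤ p := le_trans (le_max_right _ _) hp1
    obtain ⟨h2, hne, heq⟩ := hP₀ p hp hP₀p
    have hne' : ((Finset.range (p ^ 2)).filter (fun n : ℕ => localStat f p n ≠ 0)).card ≤ D' * p :=
      le_trans hne (Nat.mul_le_mul_right p (Nat.le_succ D))
    have heq' : ((Finset.range (p ^ 2)).filter (fun n : ℕ => localStat f p n = 2)).card ≤ D' :=
      le_trans heq (Nat.le_succ D)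
    exact stub_localRootBound p D' (fun n => localStat f p n) (Nat.succ_le_succ (Nat.zero_le D)) h8
      (fun n _ => h2 n) hne' heq'
  refine ⟨(∑ p ∈ Finset.range P₁, T (eulerFactor f p)) +
    128 * (D' : ℝ) ^ 2 * ∑' n : ℕ, 1 / (n : ℝ) ^ 2, fun y => ?_⟩
  have hadd : T (eulerSpecies f y) =
      ∑ p ∈ (Finset.range (y + 1)).filter Nat.Prime, T (eulerFactor f p) :=
    stub_eulerAdditivity k f y
  rw [hadd, ← Finset.sum_filter_add_sum_filter_not ((Finset.range (y + 1)).filter Nat.Prime)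
    (fun p : ℕ => p < P₁)]
  refine add_le_add ?_ ?_
  · refine Finset.sum_le_sum_of_subset_of_nonneg (fun p hp => ?_) (fun p _ _ => T_nonneg _)
    simp only [Finset.mem_filter, Finset.mem_range] at hp ⊢
    exact hp.2
  · calc ∑ p ∈ ((Finset.range (y + 1)).filter Nat.Prime).filter (fun p : ℕ => ¬ p < P₁),
            T (eulerFactor f p)
          ≤ ∑ p ∈ ((Finset.range (y + 1)).filter Nat.Prime).filter (fun p : ℕ => ¬ p < P₁),
            128 * (D' : ℝ) ^ 2 * (1 / (p : ℝ) ^ 2) := by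
            refine Finset.sum_le_sum fun p hp => ?_
            simp only [Finset.mem_filter, Finset.mem_range, not_lt] at hp
            have h := hlarge p hp.1.2 hp.2
            rw [mul_one_div]
            exact h
      _ = 128 * (D' : ℝ) ^ 2 * ∑ p ∈ ((Finset.range (y + 1)).filter Nat.Prime).filter
            (fun p : ℕ => ¬ p < P₁), 1 / (p : ℝ) ^ 2 := by rw [Finset.mul_sum]
      _ ≤ 128 * (D' : ℝ) ^ 2 * ∑' n : ℕ, 1 / (n : ℝ) ^ 2 := by
            gcongr
            exact (Real.summable_one_div_nat_pow.mpr one_lt_two).sum_le_tsum _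
              (fun n _ => by positivity)

/-- The far part of `T` at radius `r` (roots with `r < ‖1−ρ‖`) is at most the sum over the roots with
`r ≤ ‖1−ρ‖` (the first lead's far-zone sum): nonnegative summands, smaller index multiset. -/
theorem Tfar_le_sum_filter_le (P : Polynomial ℂ) (r : ℝ) :
    Tfar P r ≤ ((P.roots.filter (fun ρ : ℂ => r ≤ ‖(1 : ℂ) - ρ‖)).map
      (fun ρ : ℂ => (‖(1 : ℂ) - ρ‖ ^ 2)⁻¹)).sum := by
  unfold Tfar
  set t := P.roots.filter (fun ρ : ℂ => r ≤ ‖(1 : ℂ) - ρ‖) with ht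
  have hff : t.filter (fun ρ : ℂ => r < ‖(1 : ℂ) - ρ‖) = P.roots.filter (fun ρ : ℂ => r < ‖(1 : ℂ) - ρ‖) := by
    rw [ht, Multiset.filter_filter]
    exact Multiset.filter_congr fun ρ _ => ⟨fun h => h.1, fun h => ⟨h, h.le⟩⟩
  have hnn : 0 ≤ ((t.filter (fun ρ : ℂ => ¬ r < ‖(1 : ℂ) - ρ‖)).map
      (fun ρ : ℂ => (‖(1 : ℂ) - ρ‖ ^ 2)⁻¹)).sum := by
    refine Multiset.sum_nonneg fun v hv => ?_
    obtain ⟨ρ, _, rfl⟩ := Multiset.mem_map.1 hv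
    positivity
  calc ((P.roots.filter (fun ρ : ℂ => r < ‖(1 : ℂ) - ρ‖)).map (fun ρ : ℂ => (‖(1 : ℂ) - ρ‖ ^ 2)⁻¹)).sum
      = ((t.filter (fun ρ : ℂ => r < ‖(1 : ℂ) - ρ‖)).map (fun ρ : ℂ => (‖(1 : ℂ) - ρ‖ ^ 2)⁻¹)).sum := by
        rw [hff]
    _ ≤ ((t.filter (fun ρ : ℂ => r < ‖(1 : ℂ) - ρ‖)).map (fun ρ : ℂ => (‖(1 : ℂ) - ρ‖ ^ 2)⁻¹)).sum +
        ((t.filter (fun ρ : ℂ => ¬ r < ‖(1 : ℂ) - ρ‖)).map (fun ρ : ℂ => (‖(1 : ℂ) - ρ‖ ^ 2)⁻¹)).sum :=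
        le_add_of_nonneg_right hnn
    _ = (t.map (fun ρ : ℂ => (‖(1 : ℂ) - ρ‖ ^ 2)⁻¹)).sum := by
        rw [← Multiset.sum_add, ← Multiset.map_add, Multiset.filter_add_not]

/-- **`stub_farZoneHarmless` DERIVED (planner's K-far stub, with `K = 1`, `B = 1`)** from the registered shared joints
`stub_farMomentWide` (S1′) and `stub_farZone_of_farMomentWide` (S2′) of the first lead's line (one landing closes both lines' far
zone); the only glue is `Tfar ≤` the `≤`-filtered far sum (`Tfar_le_sum_filter_le`). -/
theorem stub_farZoneHarmless :
    ∀ (k : ℕ) (f : Fin k → Polynomial ℤ), Literature.NumberTheory.Sieve.IsBatemanHornSystem f →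
      ∃ K : ℝ, 0 < K ∧ ∃ B : ℕ, ∃ C : ℝ, ∃ x₀ : ℕ, ∀ x : ℕ, x₀ ≤ x →
        Tfar (sysPoly f x) (K * (loglog x) ^ B) ≤ C := by
  intro k f hf
  obtain ⟨C, x₀, hC⟩ :=
    SmoothRoughLatticeAcquisition.stub_farZone_of_farMomentWide stub_farMomentWide k f hf
  refine ⟨1, one_pos, 1, C, x₀, fun x hx => ?_⟩
  have h := hC x hx
  have hr : (1 : ℝ) * (loglog x) ^ 1 = Real.log (Real.log (x : ℝ)) := by simp [loglog]
  rw [hr]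
  exact le_trans (Tfar_le_sum_filter_le _ _) h

/-! ## Bookkeeping for the composition (sorry-free) -/

/-- `T = T_near(r) + T_far(r)` for every radius `r` (the root multiset splits by `‖1-ρ‖ ≤ r`). -/
theorem T_eq_Tnear_add_Tfar (P : Polynomial ℂ) (r : ℝ) : T P = Tnear P r + Tfar P r := by
  unfold T Tnear Tfar
  rw [← Multiset.sum_add, ← Multiset.map_add]
  congr 1
  have hfar : P.roots.filter (fun ρ : ℂ => r < ‖(1 : ℂ) - ρ‖) =
      P.roots.filter (fun ρ : ℂ => ¬ (‖(1 : ℂ) - ρ‖ ≤ r)) :=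
    Multiset.filter_congr fun ρ _ => by simp [not_le]
  rw [hfar, Multiset.filter_add_not]

/-- A real sequence bounded from some index on is bounded (finitely many earlier values). -/
theorem exists_bound_of_eventually (g : ℕ → ℝ) {x₀ : ℕ} {C : ℝ}
    (h : ∀ x : ℕ, x₀ ≤ x → g x ≤ C) : ∃ C' : ℝ, ∀ x : ℕ, g x ≤ C' := by
  refine ⟨max C 0 + ∑ i ∈ Finset.range x₀, |g i|, fun x => ?_⟩
  have hs : 0 ≤ ∑ i ∈ Finset.range x₀, |g i| := Finset.sum_nonneg fun i _ => abs_nonneg _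
  rcases le_or_gt x₀ x with hx | hx
  · calc g x ≤ C := h x hx
      _ ≤ max C 0 := le_max_left _ _
      _ ≤ max C 0 + ∑ i ∈ Finset.range x₀, |g i| := le_add_of_nonneg_right hs
  · have hmem : x ∈ Finset.range x₀ := Finset.mem_range.mpr hx
    calc g x ≤ |g x| := le_abs_self _
      _ ≤ ∑ i ∈ Finset.range x₀, |g i| :=
          Finset.single_le_sum (f := fun i => |g i|) (fun i _ => abs_nonneg _) hmem
      _ ≤ max C 0 + ∑ i ∈ Finset.range x₀, |g i| := le_add_of_nonneg_left (le_max_right _ _)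

/-! ## The composition (kernel-checked, no `sorry` of its own) -/

/-- **`SystemZeroRepulsion` from the four stubs.** Fix a system; take `C_E` (K-Euler), `K, B, C_F, x₁` (K-far),
`A₀` (K-coupling at `K, B`), `A₁` (K-rough), `A := max A₀ A₁`, then `C_C, x₂` (coupling at `A`, `ε = 1`) and
`C_R, x₃` (rough at `A`). For `x ≥ max(x₁,x₂,x₃)`:
`T(S_x) = T_near + T_far ≤ (2(T(M_y) + T(R_{x,y})) + C_C) + C_F ≤ 2C_E + 2C_R + C_C + C_F`;
the finitely many smaller `x` are absorbed into the constant, which gives the crux's `∀ x ≥ 2` (and more). -/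
theorem SystemZeroRepulsion_of : SystemZeroRepulsion := by
  intro k f hf
  obtain ⟨CE, hCE⟩ := stub_eulerSpeciesBound k f hf
  obtain ⟨K, hK, B, CF, x₁, hCF⟩ := stub_farZoneHarmless k f hf
  obtain ⟨A₀, hA₀⟩ := stub_speciesCoupling k f hf K hK B
  obtain ⟨A₁, hA₁⟩ := stub_roughZeroRepulsion k f hf
  obtain ⟨CC, x₂, hCC⟩ := hA₀ (max A₀ A₁) (le_max_left _ _) 1 one_pos
  obtain ⟨CR, x₃, hCR⟩ := hA₁ (max A₀ A₁) (le_max_right _ _)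
  have key : ∀ x : ℕ, max x₁ (max x₂ x₃) ≤ x → T (sysPoly f x) ≤ 2 * CE + 2 * CR + CC + CF := by
    intro x hx
    have hx₁ : x₁ ≤ x := le_trans (le_max_left _ _) hx
    have hx₂ : x₂ ≤ x := le_trans (le_trans (le_max_left _ _) (le_max_right _ _)) hx
    have hx₃ : x₃ ≤ x := le_trans (le_trans (le_max_right _ _) (le_max_right _ _)) hx
    have h1 := hCF x hx₁
    have h2 := hCC x hx₂
    have h3 := hCR x hx₃
    have h4 := hCE (cutoff (max A₀ A₁) x)
    rw [T_eq_Tnear_add_Tfar (sysPoly f x) (K * (loglog x) ^ B)]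
    linarith
  obtain ⟨C, hC⟩ := exists_bound_of_eventually (fun x => T (sysPoly f x)) key
  exact ⟨C, fun x _ => hC x⟩

end Summit.Parity.BatemanHorn.Cruxes.SystemZeroRepulsion.EulerSpeciesFactorisation
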